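import Summits.Ventures.QEC.Census.CertCoverCosetD
import Summits.Ventures.QEC.Census.BB.BB288.CoverL10D14
import HarnessLib

set_option Elab.async false

/-!
# `[[288,12,18]]` cover certificate — LEVEL 1→0 VERDICTS for problems 581–582: per problem `cosetOKD`, fast `buEvenOKP`,
fast `labelCheckOKP`, the lift identity, and the bundle `p_i_okD` (plain `decide`, one theorem each).
-/

namespace Summit.Ventures.QEC.Census.BB288Cover

open Summit.Ventures.QEC.Census

/-- Problem 581: coset checker (`cosetOK_of_cosetOKD D1_ker`). -/
theorem p581_coset : cosetOKD 144 bb144HX D1 p581 p581gD p581bD = true := by decide +kernel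
/-- Problem 581: inside-`U` evenness (`buEvenOK_of_P`). -/
theorem p581_bu : buEvenOKP p581 = true := by decide +kernel
/-- Problem 581: label check (`labelCheckOK_of_P`). -/
theorem p581_lab : labelCheckOKP p581l0 p581 = true := by decide +kernel
/-- Problem 581: lift identity. -/
theorem p581_lift : cov1.lift0 6178420484286704384757805160429931986944 = p581l0 := by decide +kernel
/-- Verdict bundle of problem 581. -/
theorem p581_okD : cosetOKD 144 bb144HX D1 p581 p581gD p581bD = true ∧ buEvenOKP p581 = true ∧
    labelCheckOKP p581l0 p581 = true ∧ cov1.lift0 6178420484286704384757805160429931986944 = p581l0 := ⟨p581_coset, p581_bu, p581_lab, p581_lift⟩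

/-- Problem 582: coset checker (`cosetOK_of_cosetOKD D1_ker`). -/
theorem p582_coset : cosetOKD 144 bb144HX D1 p582 p582gD p582bD = true := by decide +kernel
/-- Problem 582: inside-`U` evenness (`buEvenOK_of_P`). -/
theorem p582_bu : buEvenOKP p582 = true := by decide +kernel
/-- Problem 582: label check (`labelCheckOK_of_P`). -/
theorem p582_lab : labelCheckOKP p582l0 p582 = true := by decide +kernel
/-- Problem 582: lift identity. -/
theorem p582_lift : cov1.lift0 49766486006265338146720044422726575718400 = p582l0 := by decide +kernel
/-- Verdict bundle of problem 582. -/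
theorem p582_okD : cosetOKD 144 bb144HX D1 p582 p582gD p582bD = true ∧ buEvenOKP p582 = true ∧
    labelCheckOKP p582l0 p582 = true ∧ cov1.lift0 49766486006265338146720044422726575718400 = p582l0 := ⟨p582_coset, p582_bu, p582_lab, p582_lift⟩

end Summit.Ventures.QEC.Census.BB288Cover
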